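import Summits.NavierStokesRegularity.FluidComputer.GateBudgetSpentGate
import HarnessLib

/-!
# What no tuning can beat, part 36: THE DUD RE-ARMS — the clock of a doused gate whose
# output pair is EMPTY climbs back through zero, and the amplifier relights the trigger
# (general laws: two continuity arguments from BELOW)

Cell `pub-fluidc`, blueprint seat bp1 (gen 32, third item); same namespace and conventions as
parts 1–35 (`GateBudget*.lean`); imports part 34 (`GateBudgetSpentGate`: the a-priori laws under
a non-positive clock and the `maximalTimeP` continuity argument). Modes `0 = a` carrier,
`1 = b` clock, `2 = c` trigger, `3 = d` transfer, `4 = ã` output of `fiveGateCircuit ε σ μ R K`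
from (5.6). HONEST FRAMING (verbatim): low prior, high value-of-information experiment on Tao's
machine paradigm; NOT a claim that NS blows up. Nothing is proved about the Navier–Stokes
equations.

## What this part records (SPEC-INPUT-bp1 §AJ item (19): the second pulse itself, lower side)

Part 34 is the TOOTH side of the dichotomy after the pulse: output pair full
(`d² + ã² ≥ 1 - η`), carrier empty, clock pump off, gate spent. This part is the DUD side:
output pair EMPTY (`d(T)² + ã(T)² ≤ θ`, `θ` small), so by the energy identity the carrier is
FULL again (`a² = 1 - b² - c² - d² - ã² ≥ 1 - θ - …`) and the clock pump `b' = εa² - μc²` runs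
at nearly full rate `ε`: the doused clock MUST cross zero, and once it is positive the
amplifier `μbc` relights the trigger super-exponentially. Two continuity arguments, both from
below:

* §104 A PRIORI UNDER A CAPPED TRIGGER (`c ≤ c₀ + s(t - T)` on `[T, T']`, any sign of `b`):
  `rearm_output_apriori` — `d² + ã² ≤ d(T)² + ã(T)² + R(c₀(t - T) + s(t - T)²/2)`
  (`(d² + ã²)' = 2Rcad ≤ Rc`); `rearm_clock_apriori` — with `b² ≤ ν` a priori and
  `d(T)² + ã(T)² ≤ θ`: `b(t) ≥ b(T) + κ(t - T)`,
  `κ = ε(1 - ν - c₁² - θ - R(c₀H + sH²/2)) - μc₁²`, `c₁ = c₀ + sH`, `H ≥ T' - T`.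
* §105 `dud_clock_rearms` — THE CLOCK RE-ARMS: `b(T) ∈ [-β, 0]`, `c(T) ≤ c₀`,
  `d(T)² + ã(T)² ≤ θ`, `b² ≤ ν` on `[T, T + H]` and the BUDGET `β < κH` (`s = σ`): there is a
  zero `t_z < T + H` of the clock with `b ≤ 0` on `[T, t_z]`, `b(t_z) = 0`, the a-priori laws on
  `[T, t_z]`, `b(t) ≥ b(T) + κ(t - T)` there, and `t_z - T ≥ -b(T)/ε` (continuity argument on
  the closed condition `b ≤ 0`: at its maximal time the lower law forces `b > 0` unless the
  condition was EXITED, i.e. `b(t_z) = 0`).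
* §106 `dud_refires` — THE TRIGGER RELIGHTS: from a time `S` with `b(S) ≥ 0`, `c(S) ≤ γ`,
  `d(S)² + ã(S)² ≤ θ`, `b² ≤ ν` on `[S, S + Δ]`, `κ = ε·α - μγ² ≥ 0`
  (`α = 1 - ν - γ² - θ - RγΔ`) and the BUDGET `γ < σαδ·exp(κμ(Δ² - δ²)/2)` (`0 < δ ≤ Δ`):
  the trigger is back AT the level `γ` at some `r₁ < S + Δ`, with `c ≤ γ`, `a² ≥ α`,
  `b ≥ b(S) + κ(t - S)` and `d² + ã² ≤ θ + Rγ(t - S)` on `[S, r₁]` (continuity argument on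
  the closed condition `c ≤ γ`: under it the seed gives `c ≥ σα(t - S)`, the clock gives
  `b ≥ κ(t - S)`, and `c·exp(-κμ(t - S)²/2)` is non-decreasing — the amplifier's loop gain —
  so at `S + Δ` the trigger would exceed `γ`).

READING. For Tao's machine (parts 31–35 excluded a second pulse for `1.38` time units after
the window and showed a fired tooth is spent for `100`): a dud is NOT spent — its clock
re-arms at rate `≥ (1 - θ)ε` and its trigger relights as soon as `∫b` regains the firing
threshold; part 37 puts the numbers of the lattice dud in (`M = K¹⁰`).

HONEST LIMITS. (i) General laws only; every smallness (`ν`, `θ`, `c₀`, `γ`) is a hypothesis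
supplied by part 37 from parts 1, 32 and 34. (ii) Lower side only: the re-fire time `r₁` is
bounded ABOVE (`r₁ < S + Δ`); a lower bound on `r₁ - S` needs the decay of `c` across the
doused stretch (`c(S) ≈ c(T)e^{-M}`), which is not typed here — `c(S) ≤ c₀ + σ(S - T)` only.
(iii) The level `γ` must stay far below the trigger's natural scale (`RγΔ ≪ 1`): the theorem
certifies the START of the second pulse (trigger back at `γ`, clock positive and rising,
carrier full), not the second pulse's transfer. (iv) Nothing about Navier–Stokes.
[cite: Tao2016AveragedNS, §5.5 Theorem 5.3, (5.5), (5.6), (b-eq), (c-eq), (energy-con)]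
-/

noncomputable section

namespace Summit.NavierStokesRegularity.FluidComputer.GateBudget

open Real Set Filter Topology
open Literature.Analysis.FluidPDE.Tao2016AveragedNS
open Literature.Analysis.FluidPDE.Tao2016AveragedNS.Thm53 (antitoneOn_sub_of_deriv_le
  monotoneOn_sub_of_le_deriv)
open Literature.Analysis.ODE (maximalTimeP maximalTimeP_le_const_spec
  eq_of_maximalTimeP_le_const_lt maximalTimeP_le_const_mem)

section FiveGate

variable {ε σ μ R K : ℝ} {X : ℝ → Fin 5 → ℝ}

/-! ## §104 A priori under a capped trigger: the output pair from above, the clock from below -/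

/-- **THE OUTPUT PAIR UNDER A CAPPED TRIGGER.** Along `fiveGateCircuit ε σ μ R K` from (5.6)
(`0 ≤ σ`, `0 ≤ R`): if `c(t) ≤ c₀ + s(t - T)` on `[T, T']` (`T ≥ 0`), then
`d(t)² + ã(t)² ≤ d(T)² + ã(T)² + R(c₀(t - T) + s(t - T)²/2)` there —
`(d² + ã²)' = 2Rcad ≤ Rc` (`2ad ≤ a² + d² ≤ 1` by the energy identity, `c ≥ 0`). No sign
condition on the clock.
[cite: Tao2016AveragedNS, §5.5 Theorem 5.3, (5.5), (energy-con)] -/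
theorem rearm_output_apriori (hX : ∀ t, HasDerivAt X (fiveGateCircuit ε σ μ R K (X t)) t)
    (h0 : X 0 = delayInit) (hσ : 0 ≤ σ) (hR : 0 ≤ R) {T T' c₀ s : ℝ} (hT : 0 ≤ T)
    (hc : ∀ r ∈ Icc T T', X r 2 ≤ c₀ + s * (r - T)) {t : ℝ} (ht : t ∈ Icc T T') :
    X t 3 ^ 2 + X t 4 ^ 2
      ≤ X T 3 ^ 2 + X T 4 ^ 2 + R * (c₀ * (t - T) + s * (t - T) ^ 2 / 2) := by
  have hanti := antitoneOn_sub_of_deriv_le (f := fun r => X r 3 ^ 2 + X r 4 ^ 2)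
    (f' := fun r => 2 * R * X r 2 * X r 0 * X r 3)
    (φ := fun r => R * (c₀ + s * (r - T)))
    (Φ := fun r => R * (c₀ * (r - T) + s * (r - T) ^ 2 / 2))
    (convex_Icc T T') (fun r _ => out_energy (hX r))
    (fun r _ => by
      have h1 : HasDerivAt (fun x => R * (c₀ * (x - T) + s * (x - T) ^ 2 / 2))
          (R * (c₀ * 1 + s * (↑(2 : ℕ) * (r - T) ^ (2 - 1) * 1) / 2)) r :=
        ((((hasDerivAt_id' r).sub_const T).const_mul c₀).add
          (((((hasDerivAt_id' r).sub_const T).pow 2).const_mul s).div_const 2)).const_mul R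
      refine h1.congr_deriv ?_
      simp only [show (2 : ℕ) - 1 = 1 from rfl, pow_one, Nat.cast_ofNat]
      ring)
    (fun r hr => by
      have hc0 : 0 ≤ X r 2 := c_nonneg hX h0 hσ (hT.trans hr.1)
      have hE : X r 0 ^ 2 + X r 1 ^ 2 + X r 2 ^ 2 + X r 3 ^ 2 + X r 4 ^ 2 = 1 := by
        simpa [energy, Fin.sum_univ_five] using energy_init hX h0 r
      have had : 2 * (X r 0 * X r 3) ≤ 1 := by
        nlinarith [sq_nonneg (X r 0 - X r 3), sq_nonneg (X r 1), sq_nonneg (X r 2),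
          sq_nonneg (X r 4)]
      show 2 * R * X r 2 * X r 0 * X r 3 ≤ R * (c₀ + s * (r - T))
      have h1 : 2 * R * X r 2 * X r 0 * X r 3 ≤ R * X r 2 := by
        have := mul_le_mul_of_nonneg_left had (mul_nonneg hR hc0)
        nlinarith [this]
      have h2 : R * X r 2 ≤ R * (c₀ + s * (r - T)) := mul_le_mul_of_nonneg_left (hc r hr) hR
      linarith)
  have h := hanti (left_mem_Icc.2 (ht.1.trans ht.2)) ht ht.1
  dsimp only at h
  have hΦT : R * (c₀ * (T - T) + s * (T - T) ^ 2 / 2) = 0 := by ring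
  linarith

/-- **THE CLOCK FROM BELOW UNDER A CAPPED TRIGGER.** Same hypotheses, `0 ≤ ε, μ, s`,
`T' - T ≤ H`, the output pair EMPTY at `T` (`d(T)² + ã(T)² ≤ θ`) and the clock a priori small
(`b(t)² ≤ ν` on `[T, T']`): with `c₁ = c₀ + sH` and
`κ = ε(1 - ν - c₁² - θ - R(c₀H + sH²/2)) - μc₁²`, `b(t) ≥ b(T) + κ(t - T)` on `[T, T']` —
`b' = εa² - μc²`, `c ≤ c₁`, and the carrier is what the other four modes leave:
`a² = 1 - b² - c² - (d² + ã²) ≥ 1 - ν - c₁² - θ - R(c₀H + sH²/2)` (`rearm_output_apriori`).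
[cite: Tao2016AveragedNS, §5.5 Theorem 5.3, (5.5), (b-eq), (energy-con)] -/
theorem rearm_clock_apriori (hX : ∀ t, HasDerivAt X (fiveGateCircuit ε σ μ R K (X t)) t)
    (h0 : X 0 = delayInit) (hε : 0 ≤ ε) (hσ : 0 ≤ σ) (hμ : 0 ≤ μ) (hR : 0 ≤ R)
    {T T' c₀ s θ ν H : ℝ} (hT : 0 ≤ T) (hs : 0 ≤ s) (hTH : T' - T ≤ H)
    (hc : ∀ r ∈ Icc T T', X r 2 ≤ c₀ + s * (r - T)) (hθ : X T 3 ^ 2 + X T 4 ^ 2 ≤ θ)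
    (hν : ∀ r ∈ Icc T T', X r 1 ^ 2 ≤ ν) {t : ℝ} (ht : t ∈ Icc T T') :
    X T 1 + (ε * (1 - ν - (c₀ + s * H) ^ 2 - θ - R * (c₀ * H + s * H ^ 2 / 2))
      - μ * (c₀ + s * H) ^ 2) * (t - T) ≤ X t 1 := by
  have hTc := hc T (left_mem_Icc.2 (ht.1.trans ht.2))
  rw [show c₀ + s * (T - T) = c₀ by ring] at hTc
  have hc0 : 0 ≤ c₀ := (c_nonneg hX h0 hσ hT).trans hTc
  have hmono := monotoneOn_sub_of_le_deriv (f := fun r => X r 1)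
    (f' := fun r => ε * X r 0 ^ 2 - μ * X r 2 ^ 2)
    (φ := fun _ => ε * (1 - ν - (c₀ + s * H) ^ 2 - θ - R * (c₀ * H + s * H ^ 2 / 2))
      - μ * (c₀ + s * H) ^ 2)
    (Φ := fun r => (ε * (1 - ν - (c₀ + s * H) ^ 2 - θ - R * (c₀ * H + s * H ^ 2 / 2))
      - μ * (c₀ + s * H) ^ 2) * r)
    (convex_Icc T T') (fun r _ => hasDerivAt_b hX r)
    (fun r _ => ((hasDerivAt_id' r).const_mul _).congr_deriv (by simp))
    (fun r hr => by
      have hc0r : 0 ≤ X r 2 := c_nonneg hX h0 hσ (hT.trans hr.1)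
      have hout := rearm_output_apriori hX h0 hσ hR hT hc hr
      have hE : X r 0 ^ 2 + X r 1 ^ 2 + X r 2 ^ 2 + X r 3 ^ 2 + X r 4 ^ 2 = 1 := by
        simpa [energy, Fin.sum_univ_five] using energy_init hX h0 r
      have hrT : r - T ≤ H := by linarith [hr.2]
      have h0r : 0 ≤ r - T := by linarith [hr.1]
      -- the trigger below its cap at the far end of the window
      have hc1 : X r 2 ≤ c₀ + s * H := by
        have := mul_le_mul_of_nonneg_left hrT hs
        linarith [hc r hr]
      have hc2 : X r 2 ^ 2 ≤ (c₀ + s * H) ^ 2 := pow_le_pow_left₀ hc0r hc1 2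
      have hμc : μ * X r 2 ^ 2 ≤ μ * (c₀ + s * H) ^ 2 := mul_le_mul_of_nonneg_left hc2 hμ
      -- the dose is monotone in the elapsed time
      have hd1 : c₀ * (r - T) ≤ c₀ * H := mul_le_mul_of_nonneg_left hrT hc0
      have hd2 : (r - T) ^ 2 ≤ H ^ 2 := pow_le_pow_left₀ h0r hrT 2
      have hd3 : s * (r - T) ^ 2 ≤ s * H ^ 2 := mul_le_mul_of_nonneg_left hd2 hs
      have hdose : R * (c₀ * (r - T) + s * (r - T) ^ 2 / 2) ≤ R * (c₀ * H + s * H ^ 2 / 2) :=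
        mul_le_mul_of_nonneg_left (by linarith) hR
      have ha : 1 - ν - (c₀ + s * H) ^ 2 - θ - R * (c₀ * H + s * H ^ 2 / 2) ≤ X r 0 ^ 2 := by
        linarith [hν r hr]
      have hεa := mul_le_mul_of_nonneg_left ha hε
      show ε * (1 - ν - (c₀ + s * H) ^ 2 - θ - R * (c₀ * H + s * H ^ 2 / 2))
        - μ * (c₀ + s * H) ^ 2 ≤ ε * X r 0 ^ 2 - μ * X r 2 ^ 2
      linarith)
  have h := hmono (left_mem_Icc.2 (ht.1.trans ht.2)) ht ht.1
  dsimp only at h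
  have e : (ε * (1 - ν - (c₀ + s * H) ^ 2 - θ - R * (c₀ * H + s * H ^ 2 / 2))
      - μ * (c₀ + s * H) ^ 2) * (t - T)
      = (ε * (1 - ν - (c₀ + s * H) ^ 2 - θ - R * (c₀ * H + s * H ^ 2 / 2))
        - μ * (c₀ + s * H) ^ 2) * t
        - (ε * (1 - ν - (c₀ + s * H) ^ 2 - θ - R * (c₀ * H + s * H ^ 2 / 2))
          - μ * (c₀ + s * H) ^ 2) * T := by ring
  linarith

/-! ## §105 The clock of a dud re-arms: the continuity argument from below -/

/-- **THE CLOCK RE-ARMS.** Along `fiveGateCircuit ε σ μ R K` from (5.6) (`0 ≤ ε, σ, μ, R`): if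
at `T ≥ 0` the clock is doused but bounded, `-β ≤ b(T) ≤ 0`, the trigger is at `c(T) ≤ c₀`, the
output pair is EMPTY, `d(T)² + ã(T)² ≤ θ`, the clock is a priori small, `b² ≤ ν` on
`[T, T + H]` (`H ≥ 0`), and the BUDGET `β < κH` holds with
`κ = ε(1 - ν - c₁² - θ - R(c₀H + σH²/2)) - μc₁²`, `c₁ = c₀ + σH`, then there is a time
`t_z ∈ [T, T + H)`, THE ZERO OF THE CLOCK, with: `b ≤ 0` on `[T, t_z]`, `b(t_z) = 0`,
`c(t) ≤ c₀ + σ(t - T)` and `d(t)² + ã(t)² ≤ θ + R(c₀(t - T) + σ(t - T)²/2)` and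
`b(t) ≥ b(T) + κ(t - T)` on `[T, t_z]`, and `ε(t_z - T) ≥ -b(T)`. Continuity argument: the
maximal time of the closed condition `b ≤ 0` on `[T, T + H]` carries part 34's
`spent_trigger_apriori` and §104, whence `b ≥ -β + κ(t - T)` there; at `T + H` this would be
positive, so the condition is exited earlier, at a zero of `b`; `b' ≤ ε` (`clock_recovery`)
times the zero from below.
[cite: Tao2016AveragedNS, §5.5 Theorem 5.3, (5.5), (b-eq), (c-eq), (energy-con)] -/
theorem dud_clock_rearms (hX : ∀ t, HasDerivAt X (fiveGateCircuit ε σ μ R K (X t)) t)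
    (h0 : X 0 = delayInit) (hε : 0 ≤ ε) (hσ : 0 ≤ σ) (hμ : 0 ≤ μ) (hR : 0 ≤ R)
    {T β c₀ θ ν H : ℝ} (hT : 0 ≤ T) (hbT : X T 1 ≤ 0) (hβ : -β ≤ X T 1) (hc₀ : X T 2 ≤ c₀)
    (hθ : X T 3 ^ 2 + X T 4 ^ 2 ≤ θ) (hν : ∀ r ∈ Icc T (T + H), X r 1 ^ 2 ≤ ν) (hH : 0 ≤ H)
    (hbud : β < (ε * (1 - ν - (c₀ + σ * H) ^ 2 - θ - R * (c₀ * H + σ * H ^ 2 / 2))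
      - μ * (c₀ + σ * H) ^ 2) * H) :
    ∃ tz ∈ Icc T (T + H), tz < T + H ∧ X tz 1 = 0 ∧ (∀ r ∈ Icc T tz, X r 1 ≤ 0) ∧
      (∀ r ∈ Icc T tz, X r 2 ≤ c₀ + σ * (r - T)) ∧
      (∀ r ∈ Icc T tz, X r 3 ^ 2 + X r 4 ^ 2 ≤ θ + R * (c₀ * (r - T) + σ * (r - T) ^ 2 / 2)) ∧
      (∀ r ∈ Icc T tz, X T 1 + (ε * (1 - ν - (c₀ + σ * H) ^ 2 - θ
        - R * (c₀ * H + σ * H ^ 2 / 2)) - μ * (c₀ + σ * H) ^ 2) * (r - T) ≤ X r 1) ∧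
      -X T 1 ≤ ε * (tz - T) := by
  have hab : T ≤ T + H := by linarith
  have hg : ContinuousOn (fun s => X s 1) (Icc T (T + H)) := (continuous_traj hX 1).continuousOn
  -- the maximal time of the closed condition `b ≤ 0`
  set tz := maximalTimeP (fun s => X s 1 ≤ 0) T (T + H) with htz
  have htzm : tz ∈ Icc T (T + H) := maximalTimeP_le_const_mem (g := fun s => X s 1) hab hbT
  have hP : ∀ r ∈ Icc T tz, X r 1 ≤ 0 :=
    fun r hr => maximalTimeP_le_const_spec (g := fun s => X s 1) hab hg hbT hr
  -- the a-priori laws on `[T, tz]`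
  have hc : ∀ r ∈ Icc T tz, X r 2 ≤ c₀ + σ * (r - T) :=
    fun r hr => spent_trigger_apriori hX h0 hσ hμ hT hc₀ hP hr
  have hνz : ∀ r ∈ Icc T tz, X r 1 ^ 2 ≤ ν := fun r hr => hν r ⟨hr.1, hr.2.trans htzm.2⟩
  have hHz : tz - T ≤ H := by linarith [htzm.2]
  have hlow : ∀ r ∈ Icc T tz, X T 1 + (ε * (1 - ν - (c₀ + σ * H) ^ 2 - θ
      - R * (c₀ * H + σ * H ^ 2 / 2)) - μ * (c₀ + σ * H) ^ 2) * (r - T) ≤ X r 1 :=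
    fun r hr => rearm_clock_apriori hX h0 hε hσ hμ hR hT hσ hHz hc hθ hνz hr
  -- `tz < T + H`: else the clock would be positive at `T + H`
  have hlt : tz < T + H := by
    rcases lt_or_eq_of_le htzm.2 with h | h
    · exact h
    · exfalso
      have hmem : T + H ∈ Icc T tz := by rw [h]; exact ⟨hab, le_rfl⟩
      have h1 := hlow (T + H) hmem
      have h2 := hP (T + H) hmem
      rw [show T + H - T = H by ring] at h1
      linarith
  have hzero : X tz 1 = 0 :=
    eq_of_maximalTimeP_le_const_lt (g := fun s => X s 1) hab hg hbT hlt
  refine ⟨tz, htzm, hlt, hzero, hP, hc, fun r hr => ?_, hlow, ?_⟩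
  · have := rearm_output_apriori hX h0 hσ hR hT hc hr
    linarith
  · have := clock_recovery hX h0 hε hμ htzm.1
    linarith

/-! ## §106 The dud re-fires: the continuity argument on the trigger -/

/-- **THE TRIGGER RELIGHTS.** Along `fiveGateCircuit ε σ μ R K` from (5.6) (`0 ≤ ε, σ, μ, R`):
if at `S ≥ 0` the clock is re-armed, `b(S) ≥ 0`, the trigger is below the level `γ`,
`c(S) ≤ γ`, the output pair is empty, `d(S)² + ã(S)² ≤ θ`, the clock is a priori small,
`b² ≤ ν` on `[S, S + Δ]`, the net pump rate `κ = εα - μγ²` is non-negative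
(`α = 1 - ν - γ² - θ - RγΔ`), and the BUDGET `γ < σαδ·exp(κμ(Δ² - δ²)/2)` holds for some
`0 < δ ≤ Δ`, then there is `r₁ ∈ [S, S + Δ)` with `c(r₁) = γ` — THE TRIGGER IS BACK AT `γ` —
and on `[S, r₁]`: `c ≤ γ`, `d² + ã² ≤ θ + Rγ(t - S)`, `b(t) ≥ b(S) + κ(t - S)`, `a² ≥ α`.
Continuity argument on the closed condition `c ≤ γ`: under it §104 gives the output and clock
laws, the seed gives `c(t) ≥ σα(t - S)` (`c' ≥ σa²`, `μbc ≥ 0`), and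
`c·exp(-κμ(t - S)²/2)` is non-decreasing (`c' = σa² + μbc ≥ μκ(t - S)c`) — the amplifier's
loop gain `exp(μ∫b)`; at `S + Δ` the trigger would be `≥ σαδ·exp(κμ(Δ² - δ²)/2) > γ`.
[cite: Tao2016AveragedNS, §5.5 Theorem 5.3, (5.5), (b-eq), (c-eq), (energy-con)] -/
theorem dud_refires (hX : ∀ t, HasDerivAt X (fiveGateCircuit ε σ μ R K (X t)) t)
    (h0 : X 0 = delayInit) (hε : 0 ≤ ε) (hσ : 0 ≤ σ) (hμ : 0 ≤ μ) (hR : 0 ≤ R)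
    {S γ θ ν Δ δ : ℝ} (hS : 0 ≤ S) (hbS : 0 ≤ X S 1) (hcS : X S 2 ≤ γ)
    (hθ : X S 3 ^ 2 + X S 4 ^ 2 ≤ θ) (hν : ∀ r ∈ Icc S (S + Δ), X r 1 ^ 2 ≤ ν)
    (hδ : 0 < δ) (hδΔ : δ ≤ Δ)
    (hκ : 0 ≤ ε * (1 - ν - γ ^ 2 - θ - R * (γ * Δ)) - μ * γ ^ 2)
    (hbud : γ < σ * (1 - ν - γ ^ 2 - θ - R * (γ * Δ)) * δ *
      exp ((ε * (1 - ν - γ ^ 2 - θ - R * (γ * Δ)) - μ * γ ^ 2) * μ * (Δ ^ 2 - δ ^ 2) / 2)) :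
    ∃ r₁ ∈ Icc S (S + Δ), r₁ < S + Δ ∧ X r₁ 2 = γ ∧ (∀ r ∈ Icc S r₁, X r 2 ≤ γ) ∧
      (∀ r ∈ Icc S r₁, X r 3 ^ 2 + X r 4 ^ 2 ≤ θ + R * (γ * (r - S))) ∧
      (∀ r ∈ Icc S r₁,
        X S 1 + (ε * (1 - ν - γ ^ 2 - θ - R * (γ * Δ)) - μ * γ ^ 2) * (r - S) ≤ X r 1) ∧
      (∀ r ∈ Icc S r₁, 1 - ν - γ ^ 2 - θ - R * (γ * Δ) ≤ X r 0 ^ 2) := by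
  set α := 1 - ν - γ ^ 2 - θ - R * (γ * Δ) with hα
  set κ := ε * α - μ * γ ^ 2 with hκdef
  have hab : S ≤ S + Δ := by linarith
  have hg : ContinuousOn (fun s => X s 2) (Icc S (S + Δ)) := (continuous_traj hX 2).continuousOn
  -- the maximal time of the closed condition `c ≤ γ`
  set r₁ := maximalTimeP (fun s => X s 2 ≤ γ) S (S + Δ) with hr₁
  have hr₁m : r₁ ∈ Icc S (S + Δ) := maximalTimeP_le_const_mem (g := fun s => X s 2) hab hcS
  have hQ : ∀ r ∈ Icc S r₁, X r 2 ≤ γ :=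
    fun r hr => maximalTimeP_le_const_spec (g := fun s => X s 2) hab hg hcS hr
  have hQ' : ∀ r ∈ Icc S r₁, X r 2 ≤ γ + 0 * (r - S) := fun r hr => by
    rw [zero_mul, add_zero]; exact hQ r hr
  have hνr : ∀ r ∈ Icc S r₁, X r 1 ^ 2 ≤ ν := fun r hr => hν r ⟨hr.1, hr.2.trans hr₁m.2⟩
  have hΔr : r₁ - S ≤ Δ := by linarith [hr₁m.2]
  -- §104 on `[S, r₁]`: output pair and clock
  have hout : ∀ r ∈ Icc S r₁, X r 3 ^ 2 + X r 4 ^ 2 ≤ θ + R * (γ * (r - S)) := fun r hr => by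
    have h := rearm_output_apriori hX h0 hσ hR hS hQ' hr
    have e : R * (γ * (r - S) + 0 * (r - S) ^ 2 / 2) = R * (γ * (r - S)) := by ring
    linarith
  have hclock : ∀ r ∈ Icc S r₁, X S 1 + κ * (r - S) ≤ X r 1 := fun r hr => by
    have h := rearm_clock_apriori hX h0 hε hσ hμ hR hS le_rfl hΔr hQ' hθ hνr hr
    have e : ε * (1 - ν - (γ + 0 * Δ) ^ 2 - θ - R * (γ * Δ + 0 * Δ ^ 2 / 2))
        - μ * (γ + 0 * Δ) ^ 2 = κ := by
      rw [hκdef, hα]; ring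
    rw [e] at h
    exact h
  have hbpos : ∀ r ∈ Icc S r₁, 0 ≤ X r 1 := fun r hr => by
    have h1 := hclock r hr
    have h2 : 0 ≤ κ * (r - S) := mul_nonneg hκ (by linarith [hr.1])
    linarith
  have hcar : ∀ r ∈ Icc S r₁, α ≤ X r 0 ^ 2 := fun r hr => by
    have hE : X r 0 ^ 2 + X r 1 ^ 2 + X r 2 ^ 2 + X r 3 ^ 2 + X r 4 ^ 2 = 1 := by
      simpa [energy, Fin.sum_univ_five] using energy_init hX h0 r
    have hc0 : 0 ≤ X r 2 := c_nonneg hX h0 hσ (hS.trans hr.1)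
    have hγ0 : 0 ≤ γ := hc0.trans (hQ r hr)
    have hc2 : X r 2 ^ 2 ≤ γ ^ 2 := pow_le_pow_left₀ hc0 (hQ r hr) 2
    have hd : R * (γ * (r - S)) ≤ R * (γ * Δ) :=
      mul_le_mul_of_nonneg_left (mul_le_mul_of_nonneg_left (by linarith [hr.2]) hγ0) hR
    rw [hα]
    linarith [hνr r hr, hout r hr]
  -- (i) the seed relights the trigger: `c(t) ≥ σα(t - S)` on `[S, r₁]`
  have hseed : ∀ r ∈ Icc S r₁, σ * α * (r - S) ≤ X r 2 := fun r hr => by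
    have hmono := monotoneOn_sub_of_le_deriv (f := fun x => X x 2)
      (f' := fun x => σ * X x 0 ^ 2 + μ * X x 1 * X x 2) (φ := fun _ => σ * α)
      (Φ := fun x => σ * α * x) (convex_Icc S r₁) (fun x _ => hasDerivAt_c hX x)
      (fun x _ => ((hasDerivAt_id' x).const_mul (σ * α)).congr_deriv (by simp))
      (fun x hx => by
        have h1 : σ * α ≤ σ * X x 0 ^ 2 := mul_le_mul_of_nonneg_left (hcar x hx) hσ
        have h2 : 0 ≤ μ * X x 1 * X x 2 :=
          mul_nonneg (mul_nonneg hμ (hbpos x hx)) (c_nonneg hX h0 hσ (hS.trans hx.1))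
        show σ * α ≤ σ * X x 0 ^ 2 + μ * X x 1 * X x 2
        linarith)
    have h := hmono (left_mem_Icc.2 hr₁m.1) hr hr.1
    dsimp only at h
    have e : σ * α * (r - S) = σ * α * r - σ * α * S := by ring
    linarith [c_nonneg hX h0 hσ hS]
  -- (ii) the amplifier's loop gain: `c·exp(-κμ(t - S)²/2)` is non-decreasing on `[S, r₁]`
  have hgrow : ∀ r ∈ Icc S r₁, ∀ r' ∈ Icc S r₁, r' ≤ r →
      X r' 2 * exp (-(μ * κ / 2) * (r' - S) ^ 2) ≤ X r 2 * exp (-(μ * κ / 2) * (r - S) ^ 2) := by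
    have hmono := monotoneOn_sub_of_le_deriv
      (f := fun x => X x 2 * exp (-(μ * κ / 2) * (x - S) ^ 2))
      (f' := fun x => (σ * X x 0 ^ 2 + μ * X x 1 * X x 2) * exp (-(μ * κ / 2) * (x - S) ^ 2)
        + X x 2 * (exp (-(μ * κ / 2) * (x - S) ^ 2) * (-(μ * κ / 2) * (2 * (x - S)))))
      (φ := fun _ => (0 : ℝ)) (Φ := fun _ => (0 : ℝ)) (convex_Icc S r₁)
      (fun x _ => by
        have hE : HasDerivAt (fun y => exp (-(μ * κ / 2) * (y - S) ^ 2))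
            (exp (-(μ * κ / 2) * (x - S) ^ 2)
              * (-(μ * κ / 2) * (↑(2 : ℕ) * (x - S) ^ (2 - 1) * 1))) x :=
          ((((hasDerivAt_id' x).sub_const S).pow 2).const_mul (-(μ * κ / 2))).exp
        refine ((hasDerivAt_c hX x).mul hE).congr_deriv ?_
        simp only [show (2 : ℕ) - 1 = 1 from rfl, pow_one, Nat.cast_ofNat, mul_one])
      (fun x _ => hasDerivAt_const x (0 : ℝ))
      (fun x hx => by
        have hex : 0 < exp (-(μ * κ / 2) * (x - S) ^ 2) := exp_pos _
        have hc0 : 0 ≤ X x 2 := c_nonneg hX h0 hσ (hS.trans hx.1)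
        have hb : κ * (x - S) ≤ X x 1 := by linarith [hclock x hx]
        have key : 0 ≤ σ * X x 0 ^ 2 + μ * X x 2 * (X x 1 - κ * (x - S)) := by
          have h1 := mul_nonneg (mul_nonneg hμ hc0) (sub_nonneg.2 hb)
          have h2 : 0 ≤ σ * X x 0 ^ 2 := by positivity
          linarith
        have e : (σ * X x 0 ^ 2 + μ * X x 1 * X x 2) * exp (-(μ * κ / 2) * (x - S) ^ 2)
            + X x 2 * (exp (-(μ * κ / 2) * (x - S) ^ 2) * (-(μ * κ / 2) * (2 * (x - S))))
            = exp (-(μ * κ / 2) * (x - S) ^ 2)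
              * (σ * X x 0 ^ 2 + μ * X x 2 * (X x 1 - κ * (x - S))) := by ring
        show (0 : ℝ) ≤ (σ * X x 0 ^ 2 + μ * X x 1 * X x 2) * exp (-(μ * κ / 2) * (x - S) ^ 2)
            + X x 2 * (exp (-(μ * κ / 2) * (x - S) ^ 2) * (-(μ * κ / 2) * (2 * (x - S))))
        rw [e]
        exact mul_nonneg hex.le key)
    intro r hr r' hr' hle
    have h := hmono hr' hr hle
    simpa using h
  -- (i) + (ii): the trigger after the seed stretch `[S, S + δ]`
  have hfinal : ∀ r ∈ Icc S r₁, S + δ ≤ r →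
      σ * α * δ * exp (κ * μ * ((r - S) ^ 2 - δ ^ 2) / 2) ≤ X r 2 := fun r hr hδr => by
    have hSδ : S + δ ∈ Icc S r₁ := ⟨by linarith, hδr.trans hr.2⟩
    have h1 := hgrow r hr (S + δ) hSδ hδr
    have h2 := hseed (S + δ) hSδ
    rw [show S + δ - S = δ by ring] at h1 h2
    have h3 := mul_le_mul_of_nonneg_right h1 (exp_pos (μ * κ / 2 * (r - S) ^ 2)).le
    have e2 : X r 2 * exp (-(μ * κ / 2) * (r - S) ^ 2) * exp (μ * κ / 2 * (r - S) ^ 2)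
        = X r 2 := by
      rw [mul_assoc, ← exp_add, neg_mul, neg_add_cancel, exp_zero, mul_one]
    have e3 : X (S + δ) 2 * exp (-(μ * κ / 2) * δ ^ 2) * exp (μ * κ / 2 * (r - S) ^ 2)
        = X (S + δ) 2 * exp (κ * μ * ((r - S) ^ 2 - δ ^ 2) / 2) := by
      rw [mul_assoc, ← exp_add]
      congr 2
      ring
    rw [e2, e3] at h3
    have hex : 0 ≤ exp (κ * μ * ((r - S) ^ 2 - δ ^ 2) / 2) := (exp_pos _).le
    exact (mul_le_mul_of_nonneg_right h2 hex).trans h3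
  -- `r₁ < S + Δ`: else the trigger would exceed `γ` at `S + Δ`
  have hlt : r₁ < S + Δ := by
    rcases lt_or_eq_of_le hr₁m.2 with h | h
    · exact h
    · exfalso
      have hmem : S + Δ ∈ Icc S r₁ := by rw [h]; exact ⟨hab, le_rfl⟩
      have h1 := hfinal (S + Δ) hmem (by linarith)
      have h2 := hQ (S + Δ) hmem
      rw [show S + Δ - S = Δ by ring] at h1
      linarith
  have hcγ : X r₁ 2 = γ := eq_of_maximalTimeP_le_const_lt (g := fun s => X s 2) hab hg hcS hlt
  exact ⟨r₁, hr₁m, hlt, hcγ, hQ, hout, hclock, hcar⟩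

end FiveGate

end Summit.NavierStokesRegularity.FluidComputer.GateBudget
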